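import Summits.FinalStateConjecture.FinalStateConjecture.Theorems.SwallowTheDatumParametricKerrBurialStubEndChartDatum
import Literature.Geometry.Lorentzian.InitialDataLocality
import Literature.Geometry.Lorentzian.InitialDataHomothety
import Literature.Geometry.Lorentzian.InitialDataDilation
import Literature.Geometry.Lorentzian.ObstructionFreeGluing

/-!
# Stub `stub_plugDataPlusFrom_of` of the line `Sketch` (crux `SwallowTheDatum.UniversalWitnessFamily`,
# item stmt-FinalStateConjecture-10051) — helper file 1: affine readings of data on `ℝ³`; gluing from local models

Generic plumbing for the surgery that assembles PlugData⁺ from the Mao–Oh–Tao gluing theorem applied at unit scale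
(everything proved; no named facts):

* §1 the affine map `y ↦ c + s y` of `E3` (`s ≠ 0`), its differential `s • id`, and the **affine reading**
  `((y ↦ c + s y)^* G).homothety (τ/s)` of a datum `G` on `ℝ³` at centre `c`, scale `s`, normalisation `τ` — the pull-back
  (`InitialDataSet.comap`) followed by the homothety `(h, k) ↦ (λ² h, λ k)`, `λ = τ/s` (`InitialDataSet.homothety`):
  `h(y) = τ² h_G(c + s y)`, `k(y) = τ s k_G(c + s y)` on the parallel frame, and the vacuum constraints at `y` for the reading
  are those of `G` at `c + s y` (`isVacuumAt_comap_iff`, `hamiltonianConstraintFn_homothety`, `momentumConstraintFn_homothety`)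
  — packaged as `exists_read` (no new definitions);
* §2 **gluing a datum on `ℝ³` from local models**: total coefficient fields which agree near every point with the
  sections of SOME datum on `ℝ³` are the sections of a datum on `ℝ³` (`exists_initialDataSet_of_localModels`), and the
  vacuum constraints at a point only see the germ (`vacAt_iff_of_sameAt_nhds`, from `isVacuumAt_congr`).

References: Bartnik–Isenberg 2004, §2 (diffeomorphism and scaling covariance, locality of the constraint map);
Mao–Oh–Tao arXiv:2308.13031, (1.2) (the scale-invariant rescaling).
-/

-- the doubled `FinalStateConjecture` path component is the summit/problem naming scheme, not a mistake
set_option linter.dupNamespace false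
-- instance search through the nested operator type `E3 →L[ℝ] E3 →L[ℝ] ℝ`
set_option maxSynthPendingDepth 3

noncomputable section

namespace Summit.FinalStateConjecture.FinalStateConjecture.Theorems.SwallowTheDatum.UniversalWitnessFamily

open scoped Manifold ContDiff Topology
open Set Filter Function Literature.Geometry.Lorentzian Literature.Geometry.Lorentzian.InitialDataSet

namespace PlugDataPlus

/-! ## §1 Affine readings -/

section Affine

variable (c : E3) (s : ℝ)

/-- The affine map `y ↦ c + s y` is smooth (in the degree `∞ + 1` required by pull-backs of data). [folklore] -/
theorem contMDiff_affine : ContMDiff (𝓡 3) (𝓡 3) (∞ + 1) (fun y : E3 ↦ c + s • y) :=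
  (contDiff_const.add (contDiff_id.const_smul s)).contMDiff

/-- The differential of the affine map `y ↦ c + s y` is `s • id`. [folklore] -/
theorem hasMFDerivAt_affine (y : E3) :
    HasMFDerivAt (𝓡 3) (𝓡 3) (fun y : E3 ↦ c + s • y) y (s • ContinuousLinearMap.id ℝ E3) :=
  (((hasFDerivAt_id y).const_smul s).const_add c).hasMFDerivAt

/-- The differential of the affine map `y ↦ c + s y` is `s • id`. [folklore] -/
theorem mfderiv_affine (y : E3) :
    mfderiv (𝓡 3) (𝓡 3) (fun y : E3 ↦ c + s • y) y = s • ContinuousLinearMap.id ℝ E3 :=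
  (hasMFDerivAt_affine c s y).mfderiv

/-- The differential of the affine map, applied: `v ↦ s v`. [folklore] -/
theorem mfderiv_affine_apply (y v : E3) :
    mfderiv (𝓡 3) (𝓡 3) (fun y : E3 ↦ c + s • y) y v = s • v := by
  rw [mfderiv_affine]; rfl

variable {s}

/-- For `s ≠ 0` the differentials of the affine map are injective. [folklore] -/
theorem injective_mfderiv_affine (hs : s ≠ 0) (y : E3) :
    Injective (mfderiv (𝓡 3) (𝓡 3) (fun y : E3 ↦ c + s • y) y) := by
  rw [mfderiv_affine]
  intro v w h
  exact smul_right_injective E3 hs h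

/-- `c + s (−c/s + y/s) = y`. [folklore] -/
theorem affine_unaffine (hs : s ≠ 0) (y : E3) :
    c + s • (-(s⁻¹ • c) + s⁻¹ • y) = y := by
  rw [smul_add, smul_neg, smul_smul, smul_smul, mul_inv_cancel₀ hs, one_smul, one_smul]
  abel

/-- `−c/s + (c + s y)/s = y`. [folklore] -/
theorem unaffine_affine (hs : s ≠ 0) (y : E3) :
    -(s⁻¹ • c) + s⁻¹ • (c + s • y) = y := by
  rw [smul_add, smul_smul, inv_mul_cancel₀ hs, one_smul]
  abel

/-- `‖−c/s + y/s‖ = ‖y − c‖/s` for `s > 0`. [folklore] -/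
theorem norm_unaffine (hs : 0 < s) (y : E3) :
    ‖-(s⁻¹ • c) + s⁻¹ • y‖ = s⁻¹ * ‖y - c‖ := by
  rw [← smul_neg, ← smul_add, norm_smul, Real.norm_eq_abs, abs_of_pos (inv_pos.2 hs), neg_add_eq_sub]

/-- `(y − c)/s = −c/s + y/s`. [folklore] -/
theorem smul_sub_eq_unaffine (y : E3) : s⁻¹ • (y - c) = -(s⁻¹ • c) + s⁻¹ • y := by
  rw [smul_sub, sub_eq_neg_add]

/-- `c + s ((y − c)/s) = y`. [folklore] -/
theorem affine_smul_sub (hs : s ≠ 0) (y : E3) : c + s • (s⁻¹ • (y - c)) = y := by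
  rw [smul_sub_eq_unaffine, affine_unaffine c hs]

/-- `‖(y − c)/s‖ = ‖y − c‖/s` for `s > 0`. [folklore] -/
theorem norm_smul_sub (hs : 0 < s) (y : E3) : ‖s⁻¹ • (y - c)‖ = s⁻¹ * ‖y - c‖ := by
  rw [smul_sub_eq_unaffine, norm_unaffine c hs]

end Affine

section Read

variable (G : InitialDataSet (𝓡 3) E3) (c : E3) {s τ : ℝ} (hs : 0 < s) (hτ : 0 < τ)

/-- The metric of the affine reading `((y ↦ c + s y)^* G).homothety (τ/s)`: `τ² h_G(c + s y)`. [cite: BartnikIsenberg2004, §2] -/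
theorem read_h_inner (y v w : E3) :
    ((G.comap (fun y : E3 ↦ c + s • y) (contMDiff_affine c s) (injective_mfderiv_affine c hs.ne')).homothety (τ / s)
        (div_pos hτ hs)).h.inner y v w = τ ^ 2 * G.h.inner (c + s • y) v w := by
  rw [homothety_h_inner, comap_h_inner, mfderiv_affine_apply, mfderiv_affine_apply]
  change (τ / s) ^ 2 * G.coordH (c + s • y) (s • v) (s • w) = τ ^ 2 * G.coordH (c + s • y) v w
  simp only [map_smul, FunLike.coe_smul, Pi.smul_apply, smul_eq_mul]
  field_simp

/-- The tensor `k` of the affine reading: `τ s k_G(c + s y)`. [cite: BartnikIsenberg2004, §2] -/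
theorem read_k (y v w : E3) :
    ((G.comap (fun y : E3 ↦ c + s • y) (contMDiff_affine c s) (injective_mfderiv_affine c hs.ne')).homothety (τ / s)
        (div_pos hτ hs)).k y v w = (τ * s) * G.k (c + s • y) v w := by
  rw [homothety_k, comap_k, mfderiv_affine_apply, mfderiv_affine_apply]
  change τ / s * G.coordK (c + s • y) (s • v) (s • w) = τ * s * G.coordK (c + s • y) v w
  simp only [map_smul, FunLike.coe_smul, Pi.smul_apply, smul_eq_mul]
  field_simp

/-- **The vacuum constraints of the affine reading at `y` are those of `G` at `c + s y`** (diffeomorphism equivariance and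
homothety covariance of the constraint map). [cite: BartnikIsenberg2004, §2] -/
theorem vacAt_read_iff (y : E3) :
    (∀ [((G.comap (fun y : E3 ↦ c + s • y) (contMDiff_affine c s) (injective_mfderiv_affine c hs.ne')).homothety (τ / s)
        (div_pos hτ hs)).metric.HasLeviCivita],
        ((G.comap (fun y : E3 ↦ c + s • y) (contMDiff_affine c s) (injective_mfderiv_affine c hs.ne')).homothety (τ / s)
          (div_pos hτ hs)).hamiltonianConstraintFn y = 0 ∧
        ((G.comap (fun y : E3 ↦ c + s • y) (contMDiff_affine c s) (injective_mfderiv_affine c hs.ne')).homothety (τ / s)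
          (div_pos hτ hs)).momentumConstraintFn y = 0) ↔
      ∀ [G.metric.HasLeviCivita],
        G.hamiltonianConstraintFn (c + s • y) = 0 ∧ G.momentumConstraintFn (c + s • y) = 0 := by
  set Gc := G.comap (fun y : E3 ↦ c + s • y) (contMDiff_affine c s) (injective_mfderiv_affine c hs.ne') with hGc
  haveI iG : G.metric.HasLeviCivita := G.metric.hasLeviCivita
  haveI iGc : Gc.metric.HasLeviCivita := Gc.metric.hasLeviCivita
  haveI iR : (Gc.homothety (τ / s) (div_pos hτ hs)).metric.HasLeviCivita :=
    (Gc.homothety (τ / s) (div_pos hτ hs)).metric.hasLeviCivita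
  have hts : (τ / s) ≠ 0 := (div_pos hτ hs).ne'
  have key : ((Gc.homothety (τ / s) (div_pos hτ hs)).hamiltonianConstraintFn y = 0 ∧
      (Gc.homothety (τ / s) (div_pos hτ hs)).momentumConstraintFn y = 0) ↔
      (G.hamiltonianConstraintFn (c + s • y) = 0 ∧ G.momentumConstraintFn (c + s • y) = 0) := by
    rw [hamiltonianConstraintFn_homothety, momentumConstraintFn_homothety, mul_eq_zero, smul_eq_zero,
      or_iff_right (inv_ne_zero (pow_ne_zero 2 hts)), or_iff_right (inv_ne_zero hts)]
    exact isVacuumAt_comap_iff G (contMDiff_affine c s) (injective_mfderiv_affine c hs.ne') y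
  constructor
  · intro h _
    exact key.1 h
  · intro h _
    exact key.2 h

/-- **The affine reading of a datum on `ℝ³`** at centre `c`, scale `s > 0` and normalisation `τ > 0` (pull-back along
`y ↦ c + s y` followed by the homothety of ratio `τ/s`): a datum `Gr` on `ℝ³` with `h_{Gr}(y) = τ² h_G(c + s y)`,
`k_{Gr}(y) = τ s k_G(c + s y)` on the parallel frame, vacuum at `y` exactly when `G` is at `c + s y`.
[cite: BartnikIsenberg2004, §2] -/
theorem exists_read (hs : 0 < s) (hτ : 0 < τ) :
    ∃ Gr : InitialDataSet (𝓡 3) E3,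
      (∀ y v w : E3, Gr.h.inner y v w = τ ^ 2 * G.h.inner (c + s • y) v w ∧
        Gr.k y v w = (τ * s) * G.k (c + s • y) v w) ∧
      ∀ y : E3, (∀ [Gr.metric.HasLeviCivita], Gr.hamiltonianConstraintFn y = 0 ∧ Gr.momentumConstraintFn y = 0) ↔
        ∀ [G.metric.HasLeviCivita], G.hamiltonianConstraintFn (c + s • y) = 0 ∧ G.momentumConstraintFn (c + s • y) = 0 :=
  ⟨_, fun y v w ↦ ⟨read_h_inner G c hs hτ y v w, read_k G c hs hτ y v w⟩, vacAt_read_iff G c hs hτ⟩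

end Read

/-! ## §2 Gluing from local models; locality of the vacuum constraints -/

/-- **Gluing a datum on `ℝ³` from local models.** Total fields `(h, k)` of bilinear forms on `E3` which, near every
point, are the sections of some initial data set on `E3` are the sections of an initial data set on `E3` (smoothness,
symmetry and positivity are local). [cite: BartnikIsenberg2004, §2] -/
theorem exists_initialDataSet_of_localModels {hF kF : E3 → E3 →L[ℝ] E3 →L[ℝ] ℝ}
    (hloc : ∀ y : E3, ∃ (Dy : InitialDataSet (𝓡 3) E3) (W : Set E3), IsOpen W ∧ y ∈ W ∧
      ∀ z ∈ W, hF z = Dy.h.inner z ∧ kF z = Dy.k z) :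
    ∃ D : InitialDataSet (𝓡 3) E3, (∀ y, D.h.inner y = hF y) ∧ (∀ y, D.k y = kF y) := by
  have hhs : ContDiff ℝ ∞ hF := contDiff_iff_contDiffAt.2 fun y ↦ by
    obtain ⟨Dy, W, hWo, hyW, hag⟩ := hloc y
    have h1 : ContDiffAt ℝ ∞ Dy.coordH y := (contMDiff_iff_contDiff.1 Dy.contMDiff_coordH).contDiffAt
    refine h1.congr_of_eventuallyEq ?_
    filter_upwards [hWo.mem_nhds hyW] with z hz
    exact (hag z hz).1
  have hks : ContDiff ℝ ∞ kF := contDiff_iff_contDiffAt.2 fun y ↦ by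
    obtain ⟨Dy, W, hWo, hyW, hag⟩ := hloc y
    have h1 : ContDiffAt ℝ ∞ Dy.coordK y := (contMDiff_iff_contDiff.1 Dy.contMDiff_coordK).contDiffAt
    refine h1.congr_of_eventuallyEq ?_
    filter_upwards [hWo.mem_nhds hyW] with z hz
    exact (hag z hz).2
  have hsymm : ∀ y v w, hF y v w = hF y w v := fun y v w ↦ by
    obtain ⟨Dy, W, -, hyW, hag⟩ := hloc y
    rw [(hag y hyW).1]
    exact Dy.h.symm y v w
  have hpos : ∀ y v, v ≠ 0 → 0 < hF y v v := fun y v hv ↦ by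
    obtain ⟨Dy, W, -, hyW, hag⟩ := hloc y
    rw [(hag y hyW).1]
    exact Dy.h.pos y v hv
  have hksymm : ∀ y v w, kF y v w = kF y w v := fun y v w ↦ by
    obtain ⟨Dy, W, -, hyW, hag⟩ := hloc y
    rw [(hag y hyW).2]
    exact Dy.k_symm y v w
  obtain ⟨D, hDh, hDk⟩ :=
    ParametricKerrBurial.exists_initialDataSet_of_contDiff hF kF hhs hks hsymm hpos hksymm
  exact ⟨D, fun y ↦ congrFun hDh y, fun y ↦ congrFun hDk y⟩

/-- **Locality of the vacuum constraints at a point, `SameAt` form**: data on `ℝ³` with the same sections near `y`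
satisfy the vacuum constraints at `y` simultaneously. [cite: BartnikIsenberg2004, §2] -/
theorem vacAt_iff_of_sameAt_nhds {D D' : InitialDataSet (𝓡 3) E3} {y : E3} (h : ∀ᶠ z in 𝓝 y, D.SameAt D' z) :
    (∀ [D.metric.HasLeviCivita], D.hamiltonianConstraintFn y = 0 ∧ D.momentumConstraintFn y = 0) ↔
      ∀ [D'.metric.HasLeviCivita], D'.hamiltonianConstraintFn y = 0 ∧ D'.momentumConstraintFn y = 0 := by
  haveI i1 : D.metric.HasLeviCivita := D.metric.hasLeviCivita
  haveI i2 : D'.metric.HasLeviCivita := D'.metric.hasLeviCivita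
  have key := isVacuumAt_congr (x := y) (h.mono fun z hz ↦ hz.1) (h.mono fun z hz ↦ hz.2)
  constructor
  · intro h' _
    exact key.1 h'
  · intro h' _
    exact key.2 h'

end PlugDataPlus

/-- **Registered anchor of this helper file** (sub-goal `plugDataPlusFromOfAux1_anchor` of stub `stub_plugDataPlusFrom_of`):
the affine reading of a datum on `ℝ³`, `PlugDataPlus.exists_read`. [cite: BartnikIsenberg2004, §2] -/
theorem plugDataPlusFromOfAux1_anchor : ∀ (G : InitialDataSet (𝓡 3) E3) (c : E3) (s τ : ℝ), 0 < s → 0 < τ → ∃ Gr : InitialDataSet (𝓡 3) E3, (∀ y v w : E3, Gr.h.inner y v w = τ ^ 2 * G.h.inner (c + s • y) v w ∧ Gr.k y v w = (τ * s) * G.k (c + s • y) v w) ∧ ∀ y : E3, (∀ [Gr.metric.HasLeviCivita], Gr.hamiltonianConstraintFn y = 0 ∧ Gr.momentumConstraintFn y = 0) ↔ ∀ [G.metric.HasLeviCivita], G.hamiltonianConstraintFn (c + s • y) = 0 ∧ G.momentumConstraintFn (c + s • y) = 0 :=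
  fun G c _ _ hs hτ ↦ PlugDataPlus.exists_read G c hs hτ

end Summit.FinalStateConjecture.FinalStateConjecture.Theorems.SwallowTheDatum.UniversalWitnessFamily

end
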